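import Summits.QuantumFields.YangMills.Theorems.BalabanUVNodesN15PerCubeGreenObjects
import HarnessLib

/-!
# N15 = NE2, road (c) — PROGRAMME (PC), (PC-B): THE COARSE GEOMETRY OF THE PER-CUBE EXPANSION OF `(Q′G′²Q′ᵀ)⁻¹(U)` — the far zone `Z(□)` of a cube, a Lipschitz distance minorant
# `d_Z`, the margin `d_Z ≥ w` on `supp h_□`, and the WALK-LOCALITY BOX of the cube: every cube of the cover meeting the near zone has its two-collar box inside
# `c(m_B, □) + [0, (L+10)w)^{d+1}` (dag-n15-c g28, n15-c∕299b)

Cell `pub-ymgap`, seat `pub-ymgap-dag-n15-c` (generation g28; R134 (a), s1; HUMAN RULING D-0062).  `bears_on: R4∕N15 · K3⁸ SpineGivenEndpointR13SepCoPHV (stmt-QuantumFields-27366)`;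
filed `--kind proof --supports stmt-QuantumFields-27366 --as helper` — COUNT-NEUTRAL.  0 `def`, 0 `sorry`; elementary (finite minima, `ZMod` bookkeeping).  Imports n15-c∕260
`…PerCubeGreenObjects` (`ScX`, `scH`, `cvM`, `cvSk`; through it FILE 66∕72∕119's cover: `coverCorner`, `cubeBlocks`, `coverMargin`, `coverGap_le_tdistT`, `val_blockOf_sub_of_hcube_ne_zero`,
`MP_succ_eq`).  Nothing in the tree is modified.

WHY ((PC-B), [B9] (3.95)–(3.96) p.411, Cor. 3.8 p.410).  The per-cube expansion of `(Q′G′²Q′ᵀ)⁻¹(U)` (n15-c∕299c–e) compares, at the cube `□ = □_{k₀}`, the operator `S(U^{w_□})` with the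
flat `S(𝟙)` through n15-c∕299a `hasMaj_cSop_sub_cSop_one_of_reg335_scaled`, whose output weight `e^{−δd_Z(y)}` is small where `d_Z(y)` is large: it needs (i) a set `Z ⊇` the regions
`cvSk k` of the FAR cubes, (ii) a minorant `0 ≤ d_Z ≤ dist(·, Z)` with the Lipschitz property `d_Z(y) ≤ |y − z| + d_Z(z)`, (iii) `d_Z ≥ w` on `supp h_□` (where the defect is read), and
(iv) the (3.35)-smallness of `U^{w_□}` in the trivial gauge on the two-collar boxes of all NEAR cubes — i.e. those boxes must sit in ONE box around `□` on which the class is asked.  In this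
model's cover (torus `2Lw`, cube regions of side `Lw`, `w = L^m`) the near cubes are those whose region meets the `(4w − 1)`-box `B_Z(□)` around `supp h_□`; their two-collar boxes lie in
the box `c(m_B, k₀) + [0, (L + 10)w)^{d+1}`, `m_B = Lw + 3w − 1 − m₀` — a proper box of the torus as soon as `L ≥ 10`.
* §1 `exists_distMinorant`: for any `Z ⊆ 𝕋` and cap `c ≥ 0`, `d_Z(y) := min(c, min_{z∈Z}|y − z|)` has (ii), is `≤ c`, and `= c` where `Z` is `≥ c` away.
* §2 `blockOf_up`, `scH_up` (the coarse partition `h̄_k(y) = h_k(n·y)` IS FILE 67's `coverHb`), ★ `val_sub_corner_lt` (the `ZMod` bookkeeping of three windows).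
* §3 ★★ `exists_farZone`: for every cube `k₀`, `Z := 𝕋 ∖ B_Z(k₀)` and its `d_Z` (cap `w`) satisfy (i)–(iii) (`coverGap_le_tdistT`) and (iv): `cvSk k ⊄ Z ⟹ box₂(k) ⊆ box_B(k₀)` (`L ≥ 11`).

HONEST FRAMING ∕ LIMITS.  Elementary geometry of the MODEL cover (n15-c∕262's doubled unit torus); [B9] cited for SHAPES ∕ MECHANISM only.  NE2⁺ NOT PRINTED, NOT proved; N15 of record
untouched; K3⁸ OPEN; counts UNMOVED.  Restate-immune (no Theses import).
-/

noncomputable section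

open scoped BigOperators

namespace Summit.QuantumFields.YangMills.BalabanUVNodes.N15.Gluing

open Real
open Literature.MathematicalPhysics.QuantumFieldTheory.Balaban1983to89
open Literature.MathematicalPhysics.QuantumFieldTheory.Balaban1983to89.B5Prop11Plancherel (Tor fine unitVec)
open Literature.MathematicalPhysics.QuantumFieldTheory.Balaban1983to89.B5Block118 (up bpt)
open Literature.MathematicalPhysics.QuantumFieldTheory.Balaban1983to89.B6UnitTorusCarrier (unitTorusGeo)
open Literature.MathematicalPhysics.QuantumFieldTheory.King1986.Torus (blockOf val_blockOf tdistT tdistT_nonneg tdistT_symm tdistT_self tdistT_triangle)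
open Summit.QuantumFields.YangMills.BalabanUVNodes.N15.TwoGrid (cubeBlocks mem_cubeBlocks)
open Summit.QuantumFields.YangMills.BalabanUVNodes.N15.DefectKernel (kingBlockOf_bpt)

variable {d : ℕ}

/-! ## §1 A capped distance minorant to a set of blocks -/

section Minorant

variable {M : Fin (d + 1) → ℕ} [∀ μ, NeZero (M μ)]

/-- ★ **THE CAPPED DISTANCE TO A SET**: for `Z ⊆ 𝕋` and `0 ≤ c`, `d_Z(y) := min(c, min_{z ∈ Z}|y − z|_T)` (`:= c` if `Z = ∅`) satisfies `d_Z(y) ≤ |y − z|_T` for `z ∈ Z`, `0 ≤ d_Z ≤ c`,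
the Lipschitz minorant property `d_Z(y) ≤ |y − z|_T + d_Z(z)`, and `d_Z(y) = c` whenever `Z` is `≥ c` away from `y`. [folklore] -/
theorem exists_distMinorant (Z : Set (Tor M)) {c : ℝ} (hc : 0 ≤ c) :
    ∃ dZ : Tor M → ℝ, (∀ y z, z ∈ Z → dZ y ≤ tdistT M y z) ∧ (∀ y, 0 ≤ dZ y) ∧ (∀ y z, dZ y ≤ tdistT M y z + dZ z) ∧ (∀ y, dZ y ≤ c) ∧
      (∀ y, (∀ z, z ∈ Z → c ≤ tdistT M y z) → dZ y = c) := by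
  classical
  set ZF : Finset (Tor M) := Finset.univ.filter (fun z => z ∈ Z) with hZF
  have hmem : ∀ z, z ∈ ZF ↔ z ∈ Z := fun z => by simp [hZF]
  by_cases hne : ZF.Nonempty
  · refine ⟨fun y => min c (ZF.inf' hne fun z => tdistT M y z), fun y z hz => ?_, fun y => ?_, fun y z => ?_, fun y => min_le_left _ _, fun y hy => ?_⟩
    · exact (min_le_right _ _).trans (Finset.inf'_le _ ((hmem z).2 hz))
    · exact le_min hc ((Finset.le_inf'_iff hne _).2 fun z _ => tdistT_nonneg _ _ _)
    · obtain ⟨u, hu, heq⟩ := Finset.exists_mem_eq_inf' hne (fun v => tdistT M z v)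
      have h1 : ZF.inf' hne (fun v => tdistT M y v) ≤ tdistT M y z + ZF.inf' hne (fun v => tdistT M z v) := by
        rw [heq]; exact (Finset.inf'_le _ hu).trans (tdistT_triangle _ y z u)
      have hd := tdistT_nonneg _ y z
      show min c (ZF.inf' hne fun v => tdistT M y v) ≤ tdistT M y z + min c (ZF.inf' hne fun v => tdistT M z v)
      rcases min_cases c (ZF.inf' hne fun v => tdistT M z v) with ⟨h2, -⟩ | ⟨h2, -⟩
      · rw [h2]; exact (min_le_left _ _).trans (by linarith)
      · rw [h2]; exact (min_le_right _ _).trans h1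
    · exact min_eq_left ((Finset.le_inf'_iff hne _).2 fun z hz => hy z ((hmem z).1 hz))
  · refine ⟨fun _ => c, fun y z hz => (hne ⟨z, (hmem z).2 hz⟩).elim, fun _ => hc, fun y z => le_add_of_nonneg_left (tdistT_nonneg _ _ _), fun _ => le_rfl, fun _ _ => rfl⟩

end Minorant

/-! ## §2 The coarse partition read at block corners, and the `ZMod` bookkeeping of three windows -/

section Corners

variable {M : Fin (d + 1) → ℕ} [∀ μ, NeZero (M μ)] {n : ℕ} [NeZero n]

/-- the corner site `n·y` of the block `y` lies in the block `y`. [folklore] -/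
theorem blockOf_up (y : Tor M) : blockOf n M (up n M y) = y := by
  have hb : bpt n M y (fun _ => (0 : Fin n)) = up n M y := by
    funext μ; simp [bpt, B5Block118.iota]
  rw [← hb]; exact kingBlockOf_bpt _ _ y _

end Corners

section Windows

/-- ★ **THREE WINDOWS**: in `ℤ∕N`, if `b ∈ c₂ + [0, A)`, `y₀ ∈ c_K + [0, B)`, `y₀ ∈ c_Z + [0, C)` with corners `c₂ = K − m₂`, `c_K = K − m_K`, `c_Z = K₀ − m_Z` and `m_B + m_K + 1 = m₂ + B + m_Z`,
`A + B + C ≤ N + 2`, then `b ∈ c_B + [0, A + B + C − 2)` for `c_B = K₀ − m_B`. [folklore] -/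
theorem val_sub_corner_lt {N : ℕ} [NeZero N] {Kk K₀ : ℤ} {m₂ mK mZ mB A B C : ℕ} {b y₀ : ZMod N}
    (ht : (b - (((Kk - m₂ : ℤ)) : ZMod N)).val < A) (hs : (y₀ - (((Kk - mK : ℤ)) : ZMod N)).val < B) (hr : (y₀ - (((K₀ - mZ : ℤ)) : ZMod N)).val < C)
    (hmB : mB + mK + 1 = m₂ + B + mZ) (hN : A + B + C ≤ N + 2) : (b - (((K₀ - mB : ℤ)) : ZMod N)).val < A + B + C - 2 := by
  set T : ℕ := (b - (((Kk - m₂ : ℤ)) : ZMod N)).val with hT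
  set S : ℕ := (y₀ - (((Kk - mK : ℤ)) : ZMod N)).val with hS
  set R : ℕ := (y₀ - (((K₀ - mZ : ℤ)) : ZMod N)).val with hR
  have eT : ((T : ℕ) : ZMod N) = b - (((Kk - m₂ : ℤ)) : ZMod N) := ZMod.natCast_zmod_val _
  have eS : ((S : ℕ) : ZMod N) = y₀ - (((Kk - mK : ℤ)) : ZMod N) := ZMod.natCast_zmod_val _
  have eR : ((R : ℕ) : ZMod N) = y₀ - (((K₀ - mZ : ℤ)) : ZMod N) := ZMod.natCast_zmod_val _
  -- the integer representative
  set E : ℤ := (T : ℤ) + mK - m₂ - S + R + mB - mZ with hE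
  have hE0 : 0 ≤ E := by
    have : (S : ℤ) + 1 ≤ B := by exact_mod_cast hs
    have h2 : (mB : ℤ) + mK + 1 = m₂ + B + mZ := by exact_mod_cast hmB
    simp only [hE]; omega
  have hElt : E < (A + B + C - 2 : ℕ) := by
    have h1 : (T : ℤ) + 1 ≤ A := by exact_mod_cast ht
    have h3 : (R : ℤ) + 1 ≤ C := by exact_mod_cast hr
    have h2 : (mB : ℤ) + mK + 1 = m₂ + B + mZ := by exact_mod_cast hmB
    have hABC : 2 ≤ A + B + C := by omega
    rw [Nat.cast_sub hABC]; push_cast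
    simp only [hE]; omega
  have hEN : E < N := by
    have : ((A + B + C - 2 : ℕ) : ℤ) ≤ N := by
      have hABC : 2 ≤ A + B + C := by omega
      rw [Nat.cast_sub hABC]; push_cast; linarith [show ((A + B + C : ℕ) : ℤ) ≤ N + 2 by exact_mod_cast hN]
    exact hElt.trans_le this
  have hval : b - (((K₀ - mB : ℤ)) : ZMod N) = ((E : ℤ) : ZMod N) := by
    have e1 : b = (((Kk - m₂ : ℤ)) : ZMod N) + ((T : ℕ) : ZMod N) := by rw [eT]; ring
    have e2 : (((K₀ : ℤ)) : ZMod N) = y₀ + (mZ : ZMod N) - ((R : ℕ) : ZMod N) := by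
      rw [eR]; push_cast; ring
    have e3 : y₀ = (((Kk - mK : ℤ)) : ZMod N) + ((S : ℕ) : ZMod N) := by rw [eS]; ring
    simp only [hE]
    push_cast
    rw [e2, e3] at *
    rw [e1]
    push_cast
    ring
  have hv : (((b - (((K₀ - mB : ℤ)) : ZMod N)).val : ℕ) : ℤ) = E := by
    rw [hval, ZMod.val_intCast, Int.emod_eq_of_lt hE0 hEN]
  have hfin : (((b - (((K₀ - mB : ℤ)) : ZMod N)).val : ℕ) : ℤ) < ((A + B + C - 2 : ℕ) : ℤ) := by rw [hv]; exact hElt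
  exact_mod_cast hfin

end Windows

/-! ## §3 The far zone of a cube of the cover and the walk-locality box -/

section Cover

variable {L : ℕ} [NeZero L] {mv kk : ℕ} {hL : Odd L ∧ 1 < L}

omit [NeZero L] in
/-- the coarse partition `h̄_k(y) := h_k(n·y)` (n15-c∕260's `scH` at the block corner) IS FILE 67's block representative `coverHb`. [folklore] -/
theorem scH_up (k : Fin (d + 1) → ZMod (2 * L)) (y : Tor (cvM d L mv kk hL)) :
    scH d L mv kk hL k (up (L ^ kk) (cvM d L mv kk hL) y) = coverHb (cvM d L mv kk hL) (L ^ kk) (L ^ mv) L k y := rfl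

/-- ★★ **THE FAR ZONE OF A CUBE AND THE WALK-LOCALITY BOX** (`L ≥ 11`, `w = L^m ≥ 1`): for every cube `k₀` of n15-c∕262's cover there are `Z ⊆ 𝕋` and `d_Z : 𝕋 → ℝ` with
(i) `d_Z(y) ≤ |y − z|_T` on `Z`, (ii) `0 ≤ d_Z`, `d_Z(y) ≤ |y − z|_T + d_Z(z)`, (iii) `d_Z(B(x)) ≥ w` whenever `h_{k₀}(x) ≠ 0`, and (iv) every cube `k` whose region `cvSk k` is NOT inside `Z` has
its two-collar box `{x | B(x) ∈ c(2w+1, k) + [0, 6w+3)}` inside the box `{x | B(x) ∈ c(Lw + 3w − 1 − m₀, k₀) + [0, Lw + 10w)}` (`Z = 𝕋 ∖ (c(w−1, k₀) + [0, 4w−1))`, FILE 119 `coverGap_le_tdistT`,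
§2).  The shape of [B9]'s localisation «□̃ ⊃ □» for the random walk (3.87)∕(3.95). [cite: Balaban1985BackgroundPropagators, (3.87) p.409, (3.95)–(3.96) p.411, Cor. 3.8 p.410 (shape ∕ mechanism); Balaban1984PropagatorsII, p.239] -/
theorem exists_farZone (hL : Odd L ∧ 1 < L) (hL11 : 11 ≤ L) (mv kk : ℕ) (k₀ : Fin (d + 1) → ZMod (2 * L)) :
    ∃ (Z : Set (Tor (cvM d L mv kk hL))) (dZ : Tor (cvM d L mv kk hL) → ℝ),
      (∀ y z, z ∈ Z → dZ y ≤ (unitTorusGeo L kk (cvM d L mv kk hL)).dist y z) ∧ (∀ y, 0 ≤ dZ y) ∧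
      (∀ y z, dZ y ≤ (unitTorusGeo L kk (cvM d L mv kk hL)).dist y z + dZ z) ∧
      (∀ x : ScX d L mv kk hL, scH d L mv kk hL k₀ x ≠ 0 → ((L ^ mv : ℕ) : ℝ) ≤ dZ (blockOf (L ^ kk) (cvM d L mv kk hL) x)) ∧
      (∀ k, ¬ (cvSk d L mv kk hL k ⊆ Z) →
        {x : ScX d L mv kk hL | blockOf (L ^ kk) (cvM d L mv kk hL) x ∈ cubeBlocks (cvM d L mv kk hL) (coverCorner (cvM d L mv kk hL) (L ^ mv) L (2 * L ^ mv + 1) k) (6 * L ^ mv + 3)} ⊆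
        {x : ScX d L mv kk hL | blockOf (L ^ kk) (cvM d L mv kk hL) x ∈ cubeBlocks (cvM d L mv kk hL) (coverCorner (cvM d L mv kk hL) (L ^ mv) L (L * L ^ mv + 3 * L ^ mv - 1 - coverMargin L mv) k₀) (L * L ^ mv + 10 * L ^ mv)}) := by
  classical
  have hM : ∀ ν, cvM d L mv kk hL ν = 2 * L * L ^ mv := MP_succ_eq L mv kk hL
  have hw : 0 < L ^ mv := pow_pos (by omega) _
  have hq : 2 ≤ L := by omega
  set BZ : Finset (Tor (cvM d L mv kk hL)) := cubeBlocks (cvM d L mv kk hL) (coverCorner (cvM d L mv kk hL) (L ^ mv) L (L ^ mv - 1) k₀) (4 * L ^ mv - 1) with hBZ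
  set Z : Set (Tor (cvM d L mv kk hL)) := {z | z ∉ BZ} with hZdef
  obtain ⟨dZ, h1, h2, h3, -, h5⟩ := exists_distMinorant (M := cvM d L mv kk hL) Z (c := ((L ^ mv : ℕ) : ℝ)) (Nat.cast_nonneg _)
  refine ⟨Z, dZ, fun y z hz => h1 y z hz, h2, fun y z => h3 y z, fun x hx => ?_, fun k hk => ?_⟩
  · -- (iii): the tail gap of FILE 119
    rw [h5 _ fun z hz => coverGap_le_tdistT hM hw hq hx hz]
  · -- (iv): a witness block in `cvSk k ∩ B_Z(k₀)` and the three windows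
    obtain ⟨y₀, hy₀k, hy₀Z⟩ := Set.not_subset.1 hk
    have hy₀B : y₀ ∈ BZ := by by_contra h; exact hy₀Z h
    intro x hx
    simp only [Set.mem_setOf_eq, mem_cubeBlocks] at hx ⊢
    have hs := (mem_cubeBlocks _).1 (Finset.mem_coe.1 hy₀k)
    have hr := (mem_cubeBlocks _).1 hy₀B
    intro ν
    have hm₀ : coverMargin L mv ≤ L * L ^ mv := by
      unfold coverMargin
      have : (L - 2) * L ^ mv ≤ L * L ^ mv := Nat.mul_le_mul_right _ (Nat.sub_le _ _)
      omega
    have key := val_sub_corner_lt (N := cvM d L mv kk hL ν) (Kk := (L ^ mv : ℤ) * (((k ν).val : ℤ)) - (L ^ mv : ℕ)) (K₀ := (L ^ mv : ℤ) * (((k₀ ν).val : ℤ)) - (L ^ mv : ℕ))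
      (m₂ := 2 * L ^ mv + 1) (mK := coverMargin L mv) (mZ := L ^ mv - 1) (mB := L * L ^ mv + 3 * L ^ mv - 1 - coverMargin L mv)
      (A := 6 * L ^ mv + 3) (B := L * L ^ mv) (C := 4 * L ^ mv - 1) (b := blockOf (L ^ kk) (cvM d L mv kk hL) x ν) (y₀ := y₀ ν) ?_ ?_ ?_ (by omega) (by rw [hM ν]; have h10 : 10 * L ^ mv ≤ L * L ^ mv := Nat.mul_le_mul_right _ (by omega); have e2 : 2 * L * L ^ mv = 2 * (L * L ^ mv) := (by ring); omega)
    · have e : 6 * L ^ mv + 3 + L * L ^ mv + (4 * L ^ mv - 1) - 2 = L * L ^ mv + 10 * L ^ mv := by omega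
      rw [e] at key
      convert key using 3
      simp only [coverCorner]; push_cast; ring_nf
    · convert hx ν using 3
      simp only [coverCorner]; push_cast; ring_nf
    · convert hs ν using 3
      simp only [coverCorner]; push_cast; ring_nf
    · convert hr ν using 3
      simp only [coverCorner]; push_cast; ring_nf

end Cover

end Summit.QuantumFields.YangMills.BalabanUVNodes.N15.Gluing

end
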